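import Summits.QuantumFields.BalabanUV.Beta.FP.KernelPeriodisationFib
import Summits.QuantumFields.BalabanUV.Beta.ChartConjugationRelative
import Literature.MathematicalPhysics.QuantumFieldTheory.Balaban1983to89.Beta.OneStepKernelFamily

/-!
# `BalabanUV.Beta.FP.KernelPeriodisationFibDec` — road «FP» (binder row D1), RULING R-FP-51 row **(T-PER)**, PART 2 of 2: periodisation of fibred kernels commutes
# EXACTLY with the block-contour decimation `OneStepKernelFamily.dec` (the period scaling by the blocking factor), hence `perZ P (KInvStep Lc j) = dec (Lc^j) (perZ (Lc^j·P)
# (KInv (Lc^(j+1))))`; the WRAP-AROUND estimate and DE-PERIODISATION (uniqueness) fibre by fibre; the road's `Spr` packaging and the transfer of an2's RELATIVE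
# INVERSES to the torus box (row (T-INV)'s algebraic half)

Supplier: road-P3 lineage `b2b-balaban-gan24-p3` (gen 31); SPEC W-leaf06-g41-3 (3)(4) (HOME/CLAIMS.log l.35858) + R-FP-51 [D1P3-G16-RFP51] rows (T-PER) ∕ (T-INV) ∕ (T-DEPER).
NOT IN PRINT; OUR BOOKKEEPING ([folklore]).  No `def`, no `Prop` minted, nothing cited; every hypothesis is an explicit decay ∕ invariance ∕ identity binder asserted of nothing.
CONTENT.  §1 `legPt_translate` (`OneStepKernelFamily.legPt_add`: a period shift of the coarse argument moves every leg point by `L` times the shift), **`perZ_dec : perZ P (dec L K) =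
dec L (perZ (L·P) K)`** for decaying `K`, `L ≥ 1` (finite leg sums through the absolutely convergent period sum) — the «torus `dec`» of the (T-INST-j) systems is `dec` itself on
the periodic kernel (leg contours may leave the box; the kernel form needs no wrapping), **`perZ_KInvStep`** ∕ `perZ_dec_KInv` (`decays_KInv`; every (T-INST-j) resolvent
`dec (Lc^j) (KInv (Lc^(j+m+1)))`), `dec_translate_invariant` (`shiftK_dec`), `KInvStep_translate_invariant` (`shiftK_KInvStep`; the `hBinv` binder for it), `perF_dec_apply`.  §2 **`abs_perZ_sub_le`**
(WRAP-AROUND: `|perZ M K − K| ≤ C·K_{d+1}(δ)·e^{δ·dist x y}·e^{−δ(N−1)}` entrywise for `M_i ≥ N ≥ 1`) and **`eq_of_perZ_eq`** (DE-PERIODISATION: decaying kernels with equal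
periodisations along `min M_i → ∞` are equal) — road P2's `DirichletExhaustionDeperiodise.abs_tsum_translate_sub_le` ∕ `eq_of_tsum_translate_eq` BY NAME, fibre by fibre; the
consumer-facing row (T-DEPER) is leaf-05's (`FP/DeperiodiseIdentity`, `pshift` currency) — nothing here duplicates it by name.  §3 `perF_comp_spr` (`TameKernelCalculus.Spr`
packaging) and **`perF_relInv`**: `ChartConjugationRelative.RelInv A 𝕄 E` on `ℤ^{d+1}` (an2's four rules for the co-dressed resolvent, the bordered Hessian and the range
projector), all spread and `Mℤ^{d+1}`-invariant ⇒ the four identities for `perF M A`, `perF M 𝕄`, `perF M E` — row (T-INV) = this + one finite-dimensional zero-mode lemma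
(NOT here; first refusal leaf-05).  Moves NO (CONV-C) clause and NO row-D1 binder; NOT SDF, NOT D1, NOT BetaPertH, NOT continuum, NOT Clay.  HONEST DEPENDENCY: continuum YM
on T⁴ ⇐ BetaPertH ∧ nine spine estimates (0/9 proved); BetaPertH ⇐ (D1) ∧ (D4) ∧ CAP+tail; G-an2-4 gates asym, D1 and NE2/3/4.
-/

noncomputable section

open scoped BigOperators Matrix
open Finset

namespace Summit.QuantumFields.BalabanUV.Beta.FP.KernelPeriodisationFibDec

open Literature.MathematicalPhysics.QuantumFieldTheory.Balaban1983to89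
open Literature.MathematicalPhysics.QuantumFieldTheory.Balaban1983to89.Beta
open B12Sec2to5 (l1 l1_nonneg)
open B4TorusKernel.MultiPeriod (translate translate_apply)
open B4Sect5Proof (latticeConst)
open B6Lemma24Torus (pbox)
open ExpKernelCalculus (MKer Decays shiftK)
open OneStepResolventKernel (Fib KInv decays_KInv)
open OneStepKernelFamily (dec legSet legPt legW legPt_add KInvStep shiftK_dec shiftK_KInvStep)
open Summit.QuantumFields.BalabanUV.Beta.TameKernelCalculus (Spr)
open Summit.QuantumFields.BalabanUV.Beta.ChartConjugationRelative (RelInv spr_comp)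
open Summit.QuantumFields.BalabanUV.Beta.GAN24.DirichletExhaustionDeperiodise (abs_tsum_translate_sub_le eq_of_tsum_translate_eq)
open Summit.QuantumFields.BalabanUV.Beta.FP.KernelPeriodisationFib

variable {d : ℕ} {F : Type*}

/-! ## §1 Periodisation commutes with the block-contour decimation -/

section Dec

variable (P : Fin (d + 1) → ℕ) [∀ μ, NeZero (P μ)]

omit [∀ μ, NeZero (P μ)] in
/-- a period shift of the coarse argument moves every leg point by `L` times the shift: `legPt L b (y′ + P∘m) i = legPt L b y′ i + (L·P)∘m`. -/
theorem legPt_translate (L : ℕ) (b : Fib d) (y' m : Fin (d + 1) → ℤ) (i : (Fin (d + 1) → ℕ) × ℕ) :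
    legPt L b (translate P y' m) i = translate (fun μ => L * P μ) (legPt L b y' i) m := by
  rw [translate_eq_add, legPt_add, translate_eq_add]
  congr 1
  funext μ
  simp only [Pi.smul_apply, smul_eq_mul, Nat.cast_mul]
  ring

/-- **`perZ_dec` — PERIODISATION COMMUTES WITH THE BLOCK-CONTOUR DECIMATION, the period scaling by the blocking factor**:
`perZ P (dec L K) = dec L (perZ (L·P) K)` for every decaying `K` and `L ≥ 1`. [folklore] -/
theorem perZ_dec {K : MKer (d + 1) (Fib d)} {C δ : ℝ} (hK : Decays K C δ) (hC : 0 ≤ C) (hδ : 0 < δ) {L : ℕ} (hL : 1 ≤ L) :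
    perZ P (dec L K) = dec L (perZ (fun μ => L * P μ) K) := by
  have hQ : ∀ i, 1 ≤ L * P i := fun i => Nat.one_le_iff_ne_zero.2 (Nat.mul_ne_zero (by omega) (NeZero.ne _))
  funext x' y' a b
  simp only [perZ_apply, dec, legPt_translate]
  rw [Summable.tsum_finsetSum fun i _ => ?_]
  · refine Finset.sum_congr rfl fun i _ => ?_
    rw [Summable.tsum_finsetSum fun i' _ => ?_]
    · refine Finset.sum_congr rfl fun i' _ => ?_
      rw [tsum_mul_left]
    · exact (summable_translate_of_decays hK hC hδ hQ _ _ a b).mul_left _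
  · refine summable_sum fun i' _ => ?_
    exact (summable_translate_of_decays hK hC hδ hQ _ _ a b).mul_left _

/-- **the decimated composite resolvent periodises to the decimation of the periodised packed resolvent**:
`perZ P (KInvStep Lc j) = dec (Lc^j) (perZ (Lc^j·P) (KInv (Lc^(j+1))))` (the (T-INST-j) systems' «torus `dec`» is `dec`). -/
theorem perZ_KInvStep (Lc : ℕ) [NeZero Lc] (j : ℕ) :
    perZ P (KInvStep (d := d) Lc j) = dec (Lc ^ j) (perZ (fun μ => Lc ^ j * P μ) (KInv (N := Lc ^ (j + 1)) (d := d))) := by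
  obtain ⟨δ, C, hδ, hC, hK⟩ := decays_KInv (N := Lc ^ (j + 1)) (d := d)
  exact perZ_dec P hK hC hδ (Nat.one_le_iff_ne_zero.2 (pow_ne_zero _ (NeZero.ne Lc)))

/-- `perZ P (dec L (KInv N)) = dec L (perZ (L·P) (KInv N))` — every (T-INST-j) resolvent `dec (Lc^j) (KInv (Lc^(j+m+1)))` is covered (`decays_KInv`). -/
theorem perZ_dec_KInv (L N : ℕ) [NeZero N] (hL : 1 ≤ L) :
    perZ P (dec L (KInv (N := N) (d := d))) = dec L (perZ (fun μ => L * P μ) (KInv (N := N) (d := d))) := by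
  obtain ⟨δ, C, hδ, hC, hK⟩ := decays_KInv (N := N) (d := d)
  exact perZ_dec P hK hC hδ hL

omit [∀ μ, NeZero (P μ)] in
/-- **decimation transports period-lattice invariance**: an `(L·P)ℤ^{d+1}`-invariant fine kernel decimates to a `Pℤ^{d+1}`-invariant coarse kernel (`shiftK_dec`). -/
theorem dec_translate_invariant (L : ℕ) {K : MKer (d + 1) (Fib d)}
    (hK : ∀ (m x y : Fin (d + 1) → ℤ) (a b : Fib d), K (translate (fun μ => L * P μ) x m) (translate (fun μ => L * P μ) y m) a b = K x y a b)
    (m x' y' : Fin (d + 1) → ℤ) (a b : Fib d) : dec L K (translate P x' m) (translate P y' m) a b = dec L K x' y' a b := by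
  have hv : shiftK ((L : ℤ) • fun i => (P i : ℤ) * m i) K = K := by
    funext x y c e
    have h1 : ∀ z : Fin (d + 1) → ℤ, z + (L : ℤ) • (fun i => (P i : ℤ) * m i) = translate (fun μ => L * P μ) z m := fun z => by
      rw [translate_eq_add]; congr 1; funext i; simp only [Pi.smul_apply, smul_eq_mul, Nat.cast_mul]; ring
    simp only [shiftK, h1, hK]
  have h := shiftK_dec L K (fun i => (P i : ℤ) * m i)
  rw [hv] at h
  have h' := congrFun (congrFun (congrFun (congrFun h x') y') a) b
  simp only [shiftK] at h'
  rw [translate_eq_add, translate_eq_add]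
  exact h'

omit [∀ μ, NeZero (P μ)] in
/-- **the decimated composite resolvent `KInvStep Lc j` is `Pℤ^{d+1}`-invariant whenever `Lc ∣ P_i`** (`shiftK_KInvStep`) — the `hBinv` binder of `perF_comp` for it. -/
theorem KInvStep_translate_invariant (Lc : ℕ) [NeZero Lc] (j : ℕ) (hP : ∀ i, Lc ∣ P i) (m x y : Fin (d + 1) → ℤ) (a b : Fib d) :
    KInvStep (d := d) Lc j (translate P x m) (translate P y m) a b = KInvStep (d := d) Lc j x y a b := by
  refine translate_invariant_of_shiftK P (fun t => ?_) hP m x y a b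
  have h := shiftK_KInvStep (d := d) (Lc := Lc) j (-t)
  rwa [smul_neg, neg_neg] at h

/-- the matrix form: `perF P (dec L K)` is the box restriction of `dec L (perZ (L·P) K)`. -/
theorem perF_dec_apply {K : MKer (d + 1) (Fib d)} {C δ : ℝ} (hK : Decays K C δ) (hC : 0 ≤ C) (hδ : 0 < δ) {L : ℕ} (hL : 1 ≤ L)
    (p q : Idx P (Fib d)) :
    perF P (dec L K) p q = dec L (perZ (fun μ => L * P μ) K) (p.1 : Fin (d + 1) → ℤ) (q.1 : Fin (d + 1) → ℤ) p.2 q.2 := by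
  rw [perF_apply, perZ_dec P hK hC hδ hL]

end Dec

/-! ## §2 The wrap-around estimate and de-periodisation (uniqueness) for fibred kernels -/

section Wrap

variable (M : Fin (d + 1) → ℕ)

/-- **THE WRAP-AROUND ESTIMATE**: for periods `M_i ≥ N ≥ 1`, the periodised kernel differs from the kernel by
`≤ C·K_{d+1}(δ)·e^{δ·dist x y}·e^{−δ(N−1)}` entrywise — `O(e^{−δN})` on every fixed window. [folklore] -/
theorem abs_perZ_sub_le {K : MKer (d + 1) F} {C δ : ℝ} (hK : Decays K C δ) (hC : 0 ≤ C) (hδ : 0 < δ) {N : ℕ} (hN : 1 ≤ N)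
    (hMN : ∀ i, N ≤ M i) (x y : Fin (d + 1) → ℤ) (a b : F) :
    |perZ M K x y a b - K x y a b| ≤
      C * latticeConst (d + 1) δ * Real.exp (δ * dist x y) * Real.exp (-(δ * ((N : ℝ) - 1))) :=
  abs_tsum_translate_sub_le (f := fun z => K x z a b) hδ hC (decays_dist_bound hK hC hδ.le x a b) hN hMN y

/-- **DE-PERIODISATION (uniqueness) for fibred kernels**: two decaying kernels whose periodisations agree along period vectors with
`min_i M_i → ∞` are equal. [folklore] -/
theorem eq_of_perZ_eq {K K' : MKer (d + 1) F} {C δ C' δ' : ℝ} (hK : Decays K C δ) (hC : 0 ≤ C) (hδ : 0 < δ)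
    (hK' : Decays K' C' δ') (hC' : 0 ≤ C') (hδ' : 0 < δ')
    (h : ∀ N : ℕ, ∃ M : Fin (d + 1) → ℕ, (∀ i, N ≤ M i) ∧ perZ M K = perZ M K') : K = K' := by
  funext x y a b
  have := eq_of_tsum_translate_eq (f := fun z => K x z a b) (g := fun z => K' x z a b) hδ hC
    (decays_dist_bound hK hC hδ.le x a b) hδ' hC' (decays_dist_bound hK' hC' hδ'.le x a b) fun N => ?_
  · exact congrFun this y
  · obtain ⟨M, hM, hMM⟩ := h N
    refine ⟨M, hM, fun z => ?_⟩
    have := congrFun (congrFun (congrFun (congrFun hMM x) z) a) b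
    simpa only [perZ_apply] using this

end Wrap

/-! ## §3 The road's `Spr` packaging and the transfer of RELATIVE INVERSES (row (T-INV)'s algebraic half) -/

section SprRel

variable [Fintype F] (M : Fin (d + 1) → ℕ) [∀ μ, NeZero (M μ)]

/-- **`perF_comp` in the road's `Spr` packaging** (`TameKernelCalculus.Spr A = ∃ C δ, 0 < δ ∧ Decays A C δ`). -/
theorem perF_comp_spr {A B : MKer (d + 1) F} (hA : Spr A) (hB : Spr B)
    (hBinv : ∀ (m x y : Fin (d + 1) → ℤ) (a b : F), B (translate M x m) (translate M y m) a b = B x y a b) :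
    perF M (ExpKernelCalculus.comp A B) = perF M A * perF M B := by
  obtain ⟨CA, α, hα, hA⟩ := hA
  obtain ⟨CB, β, hβ, hB⟩ := hB
  exact perF_comp M hA hB hα hβ hBinv

/-- **RELATIVE INVERSES PERIODISE TO RELATIVE INVERSES**: if `RelInv A 𝕄 E` on `ℤ^{d+1}` (`E∘A = A`, `A∘E = A`, `(A∘𝕄)∘E = E`, `(E∘𝕄)∘A = E` —
an2's four rules for the co-dressed resolvent `A`, the bordered Hessian `𝕄` and the range projector `E`), all three spread and `Mℤ^{d+1}`-invariant, then the
periodised matrices satisfy the same four identities on the torus box.  (Row (T-INV) of R-FP-51 = this + one finite-dimensional zero-mode lemma, not here.) -/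
theorem perF_relInv {A Mop E : MKer (d + 1) F} (hA : Spr A) (hM : Spr Mop) (hE : Spr E)
    (hAinv : ∀ (m x y : Fin (d + 1) → ℤ) (a b : F), A (translate M x m) (translate M y m) a b = A x y a b)
    (hMinv : ∀ (m x y : Fin (d + 1) → ℤ) (a b : F), Mop (translate M x m) (translate M y m) a b = Mop x y a b)
    (hEinv : ∀ (m x y : Fin (d + 1) → ℤ) (a b : F), E (translate M x m) (translate M y m) a b = E x y a b)
    (hR : RelInv A Mop E) :
    perF M E * perF M A = perF M A ∧ perF M A * perF M E = perF M A ∧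
      perF M A * perF M Mop * perF M E = perF M E ∧ perF M E * perF M Mop * perF M A = perF M E := by
  obtain ⟨h1, h2, h3, h4⟩ := hR
  refine ⟨?_, ?_, ?_, ?_⟩
  · rw [← perF_comp_spr M hE hA hAinv, h1]
  · rw [← perF_comp_spr M hA hE hEinv, h2]
  · rw [← perF_comp_spr M hA hM hMinv, ← perF_comp_spr M (spr_comp hA hM) hE hEinv, h3]
  · rw [← perF_comp_spr M hE hM hMinv, ← perF_comp_spr M (spr_comp hE hM) hA hAinv, h4]

end SprRel

end Summit.QuantumFields.BalabanUV.Beta.FP.KernelPeriodisationFibDec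

end
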